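import Mathlib

/-!
# Counting connected sets (lattice animals) through a point

The entropy bound of Peierls arguments and cluster expansions: in a graph whose vertices have
at most `Δ` neighbours, the number of connected vertex sets of cardinality at most `n + 1`
containing a fixed vertex `v` is at most `(Δ + 1)^{2n}`.

Proof (the folklore walk-counting argument; Friedli–Velenik, *Statistical Mechanics of
Lattice Systems*, Lemma 3.38, p. 130: "a connected graph with `N` edges has a path crossing each
edge exactly twice", and Exercise 5.3, eq. (5.27), p. 249: `#{S ∋ 0 : |S| = k} ≤ (2d)^{2k}` on
`ℤ^d`): a connected set `S ∋ v` with `#S = k + 1` is the vertex set of a closed *lazy* walk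
(each step stays or moves to a neighbour) of length `2k` from `v` — grow the covered set one
adjacent vertex at a time, splicing in a there-and-back detour — hence, padding with idle
steps, of one of length `2n` for `k ≤ n`; and there are at most `(Δ + 1)^{2n}` lazy walks of
length `2n` from `v`. (Lazy walks make the padding trivial; the price is `Δ + 1` for `Δ`.)

We work with an arbitrary adjacency relation `R` on a type `V` together with finite sets
`nbr x` containing the `R`-neighbours of `x` (no `SimpleGraph`/`LocallyFinite` structure is
required), and with connectivity of a finite set `S` expressed as: every `w ∈ S` is joined to
`v` by a chain of `R`-steps inside `S` (`Relation.ReflTransGen`). The bound is stated for an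
arbitrary finite family `𝒮` of such sets, which avoids finiteness side conditions.

## Mathlib anchors

`Relation.ReflTransGen`, `List.IsChain`, `List.isChain_append`, `List.append_of_mem`,
`Finset.card_biUnion_le`, `Finset.card_image_le`, `Finset.card_le_card`.

## References

* S. Friedli, Y. Velenik, *Statistical Mechanics of Lattice Systems: a Concrete Mathematical
  Introduction*, CUP (2017), Lemma 3.38 (p. 130) and Exercise 5.3, eq. (5.27) (p. 249).
  [FriedliVelenik2017]
-/

open Finset

namespace Literature.Probability.LatticeModels

variable {V : Type*} [DecidableEq V]

/-! ## Lazy walks -/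

section LazyWalks

variable (nbr : V → Finset V)

/-- One more step of a lazy walk, recorded as a list with the current endpoint first: from
`x :: t` step to `y :: x :: t` with `y = x` (idle) or `y ∈ nbr x`. [folklore] -/
def lazyExtend : List V → Finset (List V)
  | [] => ∅
  | x :: t => (insert x (nbr x)).image fun y => y :: x :: t

/-- The lazy walks of length `k` started at `v` (as lists, endpoint first, `v` last).
[folklore] -/
def lazyWalks (v : V) : ℕ → Finset (List V)
  | 0 => {[v]}
  | k + 1 => (lazyWalks v k).biUnion (lazyExtend nbr)

variable {nbr}

/-- There are at most `Δ + 1` one-step extensions when `#nbr x ≤ Δ`. [folklore] -/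
theorem card_lazyExtend_le {Δ : ℕ} (hΔ : ∀ x, (nbr x).card ≤ Δ) (l : List V) :
    (lazyExtend nbr l).card ≤ Δ + 1 := by
  cases l with
  | nil => simp [lazyExtend]
  | cons x t =>
    simp only [lazyExtend]
    exact card_image_le.trans ((card_insert_le _ _).trans (by simpa using hΔ x))

/-- **Counting lazy walks**: at most `(Δ + 1)^k` lazy walks of length `k` from `v`. [folklore] -/
theorem card_lazyWalks_le {Δ : ℕ} (hΔ : ∀ x, (nbr x).card ≤ Δ) (v : V) :
    ∀ k, (lazyWalks nbr v k).card ≤ (Δ + 1) ^ k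
  | 0 => by simp [lazyWalks]
  | k + 1 => by
    calc (lazyWalks nbr v (k + 1)).card
        ≤ ∑ l ∈ lazyWalks nbr v k, (lazyExtend nbr l).card := card_biUnion_le
      _ ≤ ∑ _l ∈ lazyWalks nbr v k, (Δ + 1) := sum_le_sum fun l _ => card_lazyExtend_le hΔ l
      _ = (lazyWalks nbr v k).card * (Δ + 1) := by rw [sum_const, smul_eq_mul]
      _ ≤ (Δ + 1) ^ k * (Δ + 1) := Nat.mul_le_mul_right _ (card_lazyWalks_le hΔ v k)
      _ = (Δ + 1) ^ (k + 1) := (pow_succ _ _).symm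

/-- The step relation of lazy walks read on the list: each entry is the next one or one of its
listed neighbours. [folklore] -/
def LazyStep (nbr : V → Finset V) (a b : V) : Prop := a ∈ insert b (nbr b)

/-- **Characterisation of lazy walks**: lists of length `k + 1` ending at `v` whose consecutive
entries are lazy steps. [folklore] -/
theorem mem_lazyWalks_iff {v : V} {k : ℕ} {l : List V} :
    l ∈ lazyWalks nbr v k ↔
      l.length = k + 1 ∧ l.getLast? = some v ∧ l.IsChain (LazyStep nbr) := by
  induction k generalizing l with
  | zero =>
    simp only [lazyWalks, mem_singleton, zero_add]
    constructor
    · rintro rfl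
      exact ⟨rfl, rfl, List.isChain_singleton v⟩
    · rintro ⟨hlen, hlast, -⟩
      match l, hlen with
      | [x], _ => simpa using hlast
  | succ k ih =>
    simp only [lazyWalks, mem_biUnion]
    constructor
    · rintro ⟨l', hl', hl⟩
      obtain ⟨hlen', hlast', hchain'⟩ := ih.1 hl'
      match l', hlen' with
      | x :: t, hlen' =>
        simp only [lazyExtend, mem_image] at hl
        obtain ⟨y, hy, rfl⟩ := hl
        refine ⟨by simpa using hlen', ?_, ?_⟩
        · rw [List.getLast?_cons_cons]
          exact hlast'
        · exact List.IsChain.cons_cons hy hchain'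
    · rintro ⟨hlen, hlast, hchain⟩
      match l, hlen with
      | y :: x :: t, hlen =>
        refine ⟨x :: t, ih.2 ⟨by simpa using hlen, ?_, ?_⟩, ?_⟩
        · rwa [List.getLast?_cons_cons] at hlast
        · exact (List.isChain_cons_cons.1 hchain).2
        · simp only [lazyExtend, mem_image]
          exact ⟨y, (List.isChain_cons_cons.1 hchain).1, rfl⟩

/-- Idling at the start vertex: if a lazy walk of length `k` from `v` is back at `v`, staying
put gives one of length `k + 1`, with the same set of visited vertices. [folklore] -/
theorem cons_mem_lazyWalks {v : V} {k : ℕ} {l : List V} (hl : l ∈ lazyWalks nbr v k)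
    (hhead : l.head? = some v) : v :: l ∈ lazyWalks nbr v (k + 1) := by
  simp only [lazyWalks, mem_biUnion]
  refine ⟨l, hl, ?_⟩
  match l, hhead with
  | x :: t, hx =>
    simp only [List.head?_cons, Option.some.injEq] at hx
    subst hx
    simp [lazyExtend]

/-- Padding a closed lazy walk with idle steps. [folklore] -/
theorem exists_mem_lazyWalks_of_le {v : V} {k n : ℕ} (hkn : k ≤ n) {l : List V}
    (hl : l ∈ lazyWalks nbr v k) (hhead : l.head? = some v) :
    ∃ l' ∈ lazyWalks nbr v n, l'.toFinset = l.toFinset ∧ l'.head? = some v := by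
  induction hkn with
  | refl => exact ⟨l, hl, rfl, hhead⟩
  | step _ ih =>
    obtain ⟨l', hl', hset, hhead'⟩ := ih
    refine ⟨v :: l', cons_mem_lazyWalks hl' hhead', ?_, rfl⟩
    rw [List.toFinset_cons, hset, insert_eq_of_mem]
    rw [← hset, List.mem_toFinset]
    exact List.mem_of_mem_head? hhead'

end LazyWalks

/-! ## Connected sets are traced by closed lazy walks -/

section Cover

variable {R : V → V → Prop} {nbr : V → Finset V}

/-- First exit: a chain of `R`-steps inside `S` from a point of `T` to a point outside `T`
contains a step from `T` to `S \\ T`. [folklore] -/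
theorem exists_step_out {S T : Finset V} {v s : V}
    (h : Relation.ReflTransGen (fun x y => R x y ∧ x ∈ S ∧ y ∈ S) v s) (hv : v ∈ T)
    (hs : s ∉ T) : ∃ x y, x ∈ T ∧ y ∉ T ∧ y ∈ S ∧ R x y := by
  induction h with
  | refl => exact absurd hv hs
  | @tail b c _ hbc ih =>
    by_cases hb : b ∈ T
    · exact ⟨b, c, hb, hs, hbc.2.2, hbc.1⟩
    · exact ih hb

/-- Splicing a there-and-back detour `x → y → x` into a lazy walk at an occurrence of `x`.
[folklore] -/
theorem exists_splice {v : V} {k : ℕ} {l : List V} (hl : l ∈ lazyWalks nbr v k) {x y : V}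
    (hx : x ∈ l) (hxy : y ∈ nbr x) (hyx : x ∈ nbr y) :
    ∃ l' ∈ lazyWalks nbr v (k + 2), l'.toFinset = insert y l.toFinset ∧ l'.head? = l.head? := by
  obtain ⟨A, B, rfl⟩ := List.append_of_mem hx
  obtain ⟨hlen, hlast, hchain⟩ := mem_lazyWalks_iff.1 hl
  refine ⟨A ++ x :: y :: x :: B, mem_lazyWalks_iff.2 ⟨?_, ?_, ?_⟩, ?_, ?_⟩
  · simp only [List.length_append, List.length_cons] at hlen ⊢
    omega
  · rw [← hlast]
    simp [List.getLast?_append]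
  · rw [List.isChain_append] at hchain ⊢
    refine ⟨hchain.1, ?_, fun a ha b hb => hchain.2.2 a ha b (by simpa using hb)⟩
    exact List.IsChain.cons_cons (mem_insert_of_mem hyx)
      (List.IsChain.cons_cons (mem_insert_of_mem hxy) hchain.2.1)
  · ext z
    simp only [List.mem_toFinset, List.mem_append, List.mem_cons, mem_insert]
    tauto
  · cases A <;> simp

/-- **Covering walks.** If every point of the finite set `S` is joined to `v ∈ S` by a chain of
`R`-steps inside `S` (`R` symmetric, `nbr` listing the `R`-neighbours), then `S` is exactly the
set of vertices visited by some closed lazy walk from `v` of length `2(#S - 1)`. [folklore] -/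
theorem exists_lazyWalk_cover (hR : ∀ x y, R x y → R y x) (hnbr : ∀ x y, R x y → y ∈ nbr x)
    {S : Finset V} {v : V} (hv : v ∈ S)
    (hS : ∀ w ∈ S, Relation.ReflTransGen (fun x y => R x y ∧ x ∈ S ∧ y ∈ S) v w) :
    ∃ l ∈ lazyWalks nbr v (2 * (S.card - 1)), l.toFinset = S ∧ l.head? = some v := by
  -- grow a covered subset `T ⊆ S` one vertex at a time
  have key : ∀ j, j + 1 ≤ S.card → ∃ T ⊆ S, v ∈ T ∧ T.card = j + 1 ∧
      ∃ l ∈ lazyWalks nbr v (2 * j), l.toFinset = T ∧ l.head? = some v := by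
    intro j
    induction j with
    | zero =>
      intro _
      exact ⟨{v}, by simpa using hv, mem_singleton_self v, card_singleton v, [v],
        by simp [lazyWalks], by simp, rfl⟩
    | succ j ih =>
      intro hj
      obtain ⟨T, hTS, hvT, hTcard, l, hl, hlT, hhead⟩ := ih (by omega)
      -- `T ≠ S`, so some chain from `v` leaves `T`
      obtain ⟨s, hsS, hsT⟩ : ∃ s ∈ S, s ∉ T := by
        by_contra h
        push Not at h
        have : S ⊆ T := h
        have := card_le_card this
        omega
      obtain ⟨x, y, hxT, hyT, hyS, hxy⟩ := exists_step_out (hS s hsS) hvT hsT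
      have hxl : x ∈ l := by rw [← List.mem_toFinset, hlT]; exact hxT
      obtain ⟨l', hl', hl'T, hhead'⟩ := exists_splice hl hxl (hnbr x y hxy) (hnbr y x (hR x y hxy))
      refine ⟨insert y T, insert_subset hyS hTS, mem_insert_of_mem hvT,
        by rw [card_insert_of_notMem hyT, hTcard], l', ?_, by rw [hl'T, hlT], hhead'.trans hhead⟩
      simpa [Nat.mul_succ] using hl'
  have hcard : 1 ≤ S.card := card_pos.2 ⟨v, hv⟩
  obtain ⟨T, hTS, -, hTcard, l, hl, hlT, hhead⟩ := key (S.card - 1) (by omega)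
  have hTS' : T = S := eq_of_subset_of_card_le hTS (by omega)
  exact ⟨l, hl, hlT.trans hTS', hhead⟩

/-- **Counting connected sets through a point (lattice animals).** Let `R` be a symmetric
relation on `V` and `nbr x` finite sets with `#(nbr x) ≤ Δ` containing the `R`-neighbours of
`x`. Then any finite family `𝒮` of finite sets `S`, each containing `v`, of cardinality at most
`n + 1`, and `R`-connected inside itself from `v`, has at most `(Δ + 1)^{2n}` members.
(The entropy bound of Peierls arguments and cluster expansions; lazy-walk variant of
Friedli–Velenik Lemma 3.38 and eq. (5.27), `#{S ∋ 0 : |S| = k} ≤ (2d)^{2k}` on `ℤ^d`.)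
[cite: FriedliVelenik2017, Lemma 3.38 and eq. (5.27)] -/
theorem card_connectedFamily_le (hR : ∀ x y, R x y → R y x) {Δ : ℕ} (hΔ : ∀ x, (nbr x).card ≤ Δ)
    (hnbr : ∀ x y, R x y → y ∈ nbr x) (v : V) (n : ℕ) (𝒮 : Finset (Finset V))
    (h𝒮 : ∀ S ∈ 𝒮, v ∈ S ∧ S.card ≤ n + 1 ∧
      ∀ w ∈ S, Relation.ReflTransGen (fun x y => R x y ∧ x ∈ S ∧ y ∈ S) v w) :
    𝒮.card ≤ (Δ + 1) ^ (2 * n) := by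
  have hsub : 𝒮 ⊆ (lazyWalks nbr v (2 * n)).image List.toFinset := by
    intro S hS
    obtain ⟨hv, hcard, hconn⟩ := h𝒮 S hS
    obtain ⟨l, hl, hlS, hhead⟩ := exists_lazyWalk_cover hR hnbr hv hconn
    obtain ⟨l', hl', hl'S, -⟩ := exists_mem_lazyWalks_of_le (show 2 * (S.card - 1) ≤ 2 * n by omega) hl hhead
    exact mem_image.2 ⟨l', hl', hl'S.trans hlS⟩
  exact (card_le_card hsub).trans (card_image_le.trans (card_lazyWalks_le hΔ v _))

end Cover

end Literature.Probability.LatticeModels
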